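import Literature.Topology.FourManifolds.RegularSublevelMorseLocal
import Literature.Topology.FourManifolds.AdaptedMorseConnected
import Literature.Topology.FourManifolds.ImmersionOrientation
import Literature.Geometry.Symplectic.SteinOrientation
import Literature.Geometry.Symplectic.SteinDomainShrinking
import HarnessLib

/-!
# The sublevel set of a Stein domain below its index-`2` level is a compact, connected,
# orientable `(1,1)`-handlebody

Topic `Literature/Geometry/Symplectic` (fact **F1d** of the decomposition of the stub
`stub_upsideDownLegendrianDual` of the crux `ContractibleTwistedDoubleStandard`, line
`property-r-mazur-halves`: turning a Stein–Mazur half `(W, S)` upside down inside a bisected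
closed `4`-manifold one cuts `W` at a regular interior level `c` of the `J`-convex Morse
function `φ = S.φ` having the index-`0` and index-`1` critical points below it and the
index-`2` point above it; the lower piece `V = {φ ≤ c}` must then be exhibited as a compact,
connected, orientable `4`-manifold with boundary `{φ = c}` carrying an adapted Morse function
with exactly one critical point of index `0`, one of index `1` and none of higher index).
Everything in this file is **proved**; no definition, no named fact.

* `sublevel_criticalSetOfIndex_image`, `sublevel_ncard_criticalSetOfIndex` — differential
  topology of a regular sublevel set `V = {f ≤ a}` in the interior of a compact manifold with
  boundary `M` (structure `sublevelAtlas`, adapted Morse function `f|_V + (1 - a)`, the tree's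
  `sublevel_morseData_local` = Milnor 1965, Lemma 2.9): the critical points of index `i` of
  `f|_V + (1 - a)` are those of `f` of index `i` and value `< a`, with the same count;
* `sublevel_handlebody_of_counts` — hence if the critical points of `f` below `a` are one of
  index `0`, one of index `1` and all of index `≤ 1`, then `V` is a compact connected manifold
  with boundary `{f = a}` (connectedness: one minimum, Reeb–Milnor,
  `IsMorseAdapted.connectedSpace_of_ncard_eq_one`), orientable if `M` is (pull back along the
  codimension-`0` embedding `V ↪ M`, `IsOrientable.of_isSmoothEmbedding`), and
  `f|_V + (1 - a)` is an adapted Morse function of profile `(1, 1)` with indices `≤ 1`;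
* `SteinStructure.sublevel_oneOneHandlebody`, `SteinStructure.sublevel_oneOneHandlebody_of_eq`
  — the case of the `J`-convex Morse function of a Stein structure (`{φ ≤ c} ⊂ int W` for
  `c < max φ`, `SteinStructure.isInteriorPoint_of_φ_le`; `W` is orientable by its complex
  orientation, `SteinStructure.isOrientable`), with the hypotheses either as counts below `c`
  or in the form "the critical points below `c` are exactly `crit₀ ∪ crit₁`, one point each";
  `SteinStructure.sublevel_oneOneHandlebody_exists` packages the Morse data existentially.

All statements are about the subtype `↥(φ ⁻¹' Iic c)` with the charted-space structure
`(sublevelAtlas …).chartedSpace` and the smooth structure `(sublevelAtlas …).isManifold`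
(`RegularSublevelSet.lean`); Hausdorffness and second countability are inherited from the
ambient manifold as subtype instances.

## References

* J. Milnor, *Morse theory*, Ann. of Math. Studies 51 (1963), Thm. 3.1, Thm. 3.2 and Remark
  3.3. [Milnor1963]
* J. Milnor, *Lectures on the h-cobordism theorem* (1965), Lemma 2.9, Def. 3.1.
  [MilnorHCobordism1965]
* K. Cieliebak, Ya. Eliashberg, *From Stein to Weinstein and Back*, AMS Colloquium Publ. 59
  (2012), §11 (Weinstein/Stein handlebodies and their sublevel sets). [CieliebakEliashberg2012]
* M. W. Hirsch, *Differential Topology* (1976), §4.4. [HirschDT1976]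
-/

open scoped Manifold ContDiff Topology
open Set Function

noncomputable section

universe u

/-! ### Regular sublevel sets with prescribed handle counts -/

namespace Literature.Topology.FourManifolds

section General

variable {k : ℕ} {M : Type u} [TopologicalSpace M] [ChartedSpace (EuclideanHalfSpace (k + 1)) M]
  [IsManifold (𝓡∂ (k + 1)) ∞ M]

/-- **Critical points of index `i` of the adapted Morse function `f|_V + (1 - a)` of a regular
sublevel set `V = {f ≤ a}`** (in the interior, `a` non-critical, `f` nondegenerate at its
critical points in `V`) are exactly the critical points of `f` of index `i` and value `< a`.
[cite: MilnorHCobordism1965, Lemma 2.9] -/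
theorem sublevel_criticalSetOfIndex_image (hk : 1 ≤ k) {f : M → ℝ}
    (hsmooth : ContMDiff (𝓡∂ (k + 1)) 𝓘(ℝ, ℝ) ∞ f) {a : ℝ}
    (hint : ∀ p, f p ≤ a → (𝓡∂ (k + 1)).IsInteriorPoint p)
    (hreg : ∀ p, f p = a → ¬ IsMCriticalPt (𝓡∂ (k + 1)) f p)
    (hnondeg : ∀ z, f z ≤ a → IsMCriticalPt (𝓡∂ (k + 1)) f z →
      (mhessian (𝓡∂ (k + 1)) f z).Nondegenerate) (i : ℕ) :
    letI := (sublevelAtlas hsmooth a hint hreg).chartedSpace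
    Subtype.val '' criticalSetOfIndex (𝓡∂ (k + 1)) (fun x : ↥(f ⁻¹' Iic a) => f x + (1 - a)) i =
      criticalSetOfIndex (𝓡∂ (k + 1)) f i ∩ f ⁻¹' Iio a := by
  obtain ⟨_, -, -, -, hcrit, hidx, -⟩ :=
    sublevel_morseData_local hk hsmooth hint (fun z hz hza => hreg z hza hz) hnondeg
  letI := (sublevelAtlas hsmooth a hint hreg).chartedSpace
  ext z
  simp only [mem_image, mem_criticalSetOfIndex, mem_inter_iff, mem_preimage, mem_Iio]
  constructor
  · rintro ⟨x, ⟨hx, hxi⟩, rfl⟩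
    have hx' := (hcrit x).1 hx
    exact ⟨⟨hx', by rw [← hidx x hx']; exact hxi⟩, lt_of_le_of_ne x.2 fun h => hreg x.1 h hx'⟩
  · rintro ⟨⟨hz, hzi⟩, hza⟩
    refine ⟨⟨z, hza.le⟩, ⟨(hcrit ⟨z, hza.le⟩).2 hz, ?_⟩, rfl⟩
    rw [hidx ⟨z, hza.le⟩ hz]; exact hzi

/-- **The number of critical points of index `i` of `f|_V + (1 - a)` on `V = {f ≤ a}`** is the
number of critical points of `f` of index `i` and value `< a`. [cite: MilnorHCobordism1965, Lemma 2.9] -/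
theorem sublevel_ncard_criticalSetOfIndex (hk : 1 ≤ k) {f : M → ℝ}
    (hsmooth : ContMDiff (𝓡∂ (k + 1)) 𝓘(ℝ, ℝ) ∞ f) {a : ℝ}
    (hint : ∀ p, f p ≤ a → (𝓡∂ (k + 1)).IsInteriorPoint p)
    (hreg : ∀ p, f p = a → ¬ IsMCriticalPt (𝓡∂ (k + 1)) f p)
    (hnondeg : ∀ z, f z ≤ a → IsMCriticalPt (𝓡∂ (k + 1)) f z →
      (mhessian (𝓡∂ (k + 1)) f z).Nondegenerate) (i : ℕ) :
    letI := (sublevelAtlas hsmooth a hint hreg).chartedSpace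
    (criticalSetOfIndex (𝓡∂ (k + 1)) (fun x : ↥(f ⁻¹' Iic a) => f x + (1 - a)) i).ncard =
      (criticalSetOfIndex (𝓡∂ (k + 1)) f i ∩ f ⁻¹' Iio a).ncard := by
  letI := (sublevelAtlas hsmooth a hint hreg).chartedSpace
  rw [← sublevel_criticalSetOfIndex_image hk hsmooth hint hreg hnondeg i,
    Set.ncard_image_of_injective _ Subtype.val_injective]

/-- **A regular sublevel set below the index-`2` critical points is a compact connected
`(1,1)`-handlebody.**  Let `M` be a compact manifold with boundary of dimension `k + 1 ≥ 2`,
`f : M → ℝ` smooth, `a` a level such that `V = {f ≤ a}` lies in the interior of `M`, no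
critical point of `f` lies on `{f = a}`, `f` is nondegenerate at its critical points in `V`,
and the critical points of `f` of value `< a` are: exactly one of index `0`, exactly one of
index `1`, all of index `≤ 1`.  Then, with the structure `sublevelAtlas` (Milnor 1963,
Thm. 3.1: `V` is a smooth manifold with boundary `{f = a}`), `V` is compact and connected
(one minimum: Milnor 1963, Thm. 3.2 and Remark 3.3 — `V` has the homotopy type of a `0`-cell
with `1`-cells attached; in the tree, Reeb's argument
`IsMorseAdapted.connectedSpace_of_ncard_eq_one`), orientable if `M` is (Hirsch 1976, §4.4),
the inclusion is a smooth embedding, and `f|_V + (1 - a)` is a Morse function adapted to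
`∂V` with indices `≤ 1`, one critical point of index `0` and one of index `1`.
[cite: Milnor1963, Thm. 3.1, Thm. 3.2 and Remark 3.3] [cite: MilnorHCobordism1965, Lemma 2.9] -/
theorem sublevel_handlebody_of_counts [CompactSpace M] (hk : 1 ≤ k) {f : M → ℝ}
    (hsmooth : ContMDiff (𝓡∂ (k + 1)) 𝓘(ℝ, ℝ) ∞ f) {a : ℝ}
    (hint : ∀ p, f p ≤ a → (𝓡∂ (k + 1)).IsInteriorPoint p)
    (hreg : ∀ p, f p = a → ¬ IsMCriticalPt (𝓡∂ (k + 1)) f p)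
    (hnondeg : ∀ z, f z ≤ a → IsMCriticalPt (𝓡∂ (k + 1)) f z →
      (mhessian (𝓡∂ (k + 1)) f z).Nondegenerate)
    (hle : ∀ z, IsMCriticalPt (𝓡∂ (k + 1)) f z → f z < a → morseIndex (𝓡∂ (k + 1)) f z ≤ 1)
    (h0 : (criticalSetOfIndex (𝓡∂ (k + 1)) f 0 ∩ f ⁻¹' Iio a).ncard = 1)
    (h1 : (criticalSetOfIndex (𝓡∂ (k + 1)) f 1 ∩ f ⁻¹' Iio a).ncard = 1) :
    letI := (sublevelAtlas hsmooth a hint hreg).chartedSpace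
    haveI := (sublevelAtlas hsmooth a hint hreg).isManifold
    CompactSpace ↥(f ⁻¹' Iic a) ∧ ConnectedSpace ↥(f ⁻¹' Iic a) ∧
      (IsOrientable (𝓡∂ (k + 1)) M → IsOrientable (𝓡∂ (k + 1)) ↥(f ⁻¹' Iic a)) ∧
      Manifold.IsSmoothEmbedding (𝓡∂ (k + 1)) (𝓡∂ (k + 1)) ∞ (Subtype.val : ↥(f ⁻¹' Iic a) → M) ∧
      (∀ x : ↥(f ⁻¹' Iic a), (𝓡∂ (k + 1)).IsBoundaryPoint x ↔ f x.1 = a) ∧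
      IsMorseAdapted (𝓡∂ (k + 1)) (fun x : ↥(f ⁻¹' Iic a) => f x + (1 - a)) ∧
      (∀ x : ↥(f ⁻¹' Iic a), IsMCriticalPt (𝓡∂ (k + 1)) (fun x : ↥(f ⁻¹' Iic a) => f x + (1 - a)) x →
        morseIndex (𝓡∂ (k + 1)) (fun x : ↥(f ⁻¹' Iic a) => f x + (1 - a)) x ≤ 1) ∧
      (criticalSetOfIndex (𝓡∂ (k + 1)) (fun x : ↥(f ⁻¹' Iic a) => f x + (1 - a)) 0).ncard = 1 ∧
      (criticalSetOfIndex (𝓡∂ (k + 1)) (fun x : ↥(f ⁻¹' Iic a) => f x + (1 - a)) 1).ncard = 1 := by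
  obtain ⟨_, -, hemb, hF, hcrit, hidx, hbd⟩ :=
    sublevel_morseData_local hk hsmooth hint (fun z hz hza => hreg z hza hz) hnondeg
  letI := (sublevelAtlas hsmooth a hint hreg).chartedSpace
  haveI := (sublevelAtlas hsmooth a hint hreg).isManifold
  haveI : CompactSpace ↥(f ⁻¹' Iic a) :=
    isCompact_iff_compactSpace.1 ((isClosed_Iic.preimage hsmooth.continuous).isCompact)
  have hcount : ∀ i, (criticalSetOfIndex (𝓡∂ (k + 1)) (fun x : ↥(f ⁻¹' Iic a) => f x + (1 - a)) i).ncard =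
      (criticalSetOfIndex (𝓡∂ (k + 1)) f i ∩ f ⁻¹' Iio a).ncard :=
    sublevel_ncard_criticalSetOfIndex hk hsmooth hint hreg hnondeg
  have h0' : (criticalSetOfIndex (𝓡∂ (k + 1)) (fun x : ↥(f ⁻¹' Iic a) => f x + (1 - a)) 0).ncard = 1 := by
    rw [hcount 0]; exact h0
  have h1' : (criticalSetOfIndex (𝓡∂ (k + 1)) (fun x : ↥(f ⁻¹' Iic a) => f x + (1 - a)) 1).ncard = 1 := by
    rw [hcount 1]; exact h1
  refine ⟨inferInstance, hF.connectedSpace_of_ncard_eq_one h0', fun hM =>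
    IsOrientable.of_isSmoothEmbedding hemb hM, hemb, hbd, hF, fun x hx => ?_, h0', h1'⟩
  have hx' := (hcrit x).1 hx
  rw [hidx x hx']
  exact hle x.1 hx' (lt_of_le_of_ne x.2 fun h => hreg x.1 h hx')

end General

end Literature.Topology.FourManifolds

/-! ### The Stein case -/

namespace Literature.Geometry.Symplectic

open Literature.Topology.FourManifolds

namespace SteinStructure

variable {W : Type u} [TopologicalSpace W] [T2Space W] [ChartedSpace (EuclideanHalfSpace 4) W]
  [IsManifold (𝓡∂ 4) ∞ W] [CompactSpace W] (S : SteinStructure W)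

/-- **The sublevel set `V = {φ ≤ c}` of a Stein domain below its index-`2` level is a compact,
connected, orientable `(1,1)`-handlebody.**  Let `(W, S)` be a compact Stein domain whose
`J`-convex function `φ` is a Morse function, and `c < max φ` a level through no critical point
such that the critical points of `φ` of value `< c` are one of index `0`, one of index `1`, and
all of index `≤ 1`.  Then `V = {φ ≤ c}` — in the interior of `W`
(`SteinStructure.isInteriorPoint_of_φ_le`), with the structure `sublevelAtlas` of a smooth
manifold with boundary `{φ = c}` (Milnor 1963, Thm. 3.1) — is compact, connected (Milnor 1963,
Thm. 3.2 and Remark 3.3: one `0`-handle and `1`-handles), orientable (by the complex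
orientation of `W`, `SteinStructure.isOrientable`, pulled back along the inclusion), smoothly
embedded by the inclusion, and `φ|_V + (1 - c)` is a Morse function adapted to `∂V` with
indices `≤ 1`, exactly one critical point of index `0` and exactly one of index `1`
(Cieliebak–Eliashberg 2012, §11: sublevel sets of Stein/Weinstein handlebody functions are
sub-handlebodies). [cite: Milnor1963, Thm. 3.1, Thm. 3.2 and Remark 3.3]
[cite: CieliebakEliashberg2012, §11] -/
theorem sublevel_oneOneHandlebody (hφ : IsMorse (𝓡∂ 4) S.φ) {c : ℝ} (hc : c < sSup (range S.φ))
    (hreg : ∀ p, S.φ p = c → ¬ IsMCriticalPt (𝓡∂ 4) S.φ p)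
    (hle : ∀ z, IsMCriticalPt (𝓡∂ 4) S.φ z → S.φ z < c → morseIndex (𝓡∂ 4) S.φ z ≤ 1)
    (h0 : (criticalSetOfIndex (𝓡∂ 4) S.φ 0 ∩ S.φ ⁻¹' Iio c).ncard = 1)
    (h1 : (criticalSetOfIndex (𝓡∂ 4) S.φ 1 ∩ S.φ ⁻¹' Iio c).ncard = 1) :
    letI := (sublevelAtlas (k := 3) S.φ_smooth c (fun _ h => S.isInteriorPoint_of_φ_le hc h)
      hreg).chartedSpace
    haveI := (sublevelAtlas (k := 3) S.φ_smooth c (fun _ h => S.isInteriorPoint_of_φ_le hc h)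
      hreg).isManifold
    CompactSpace ↥(S.φ ⁻¹' Iic c) ∧ ConnectedSpace ↥(S.φ ⁻¹' Iic c) ∧
      IsOrientable (𝓡∂ 4) ↥(S.φ ⁻¹' Iic c) ∧
      Manifold.IsSmoothEmbedding (𝓡∂ 4) (𝓡∂ 4) ∞ (Subtype.val : ↥(S.φ ⁻¹' Iic c) → W) ∧
      (∀ x : ↥(S.φ ⁻¹' Iic c), (𝓡∂ 4).IsBoundaryPoint x ↔ S.φ x.1 = c) ∧
      IsMorseAdapted (𝓡∂ 4) (fun x : ↥(S.φ ⁻¹' Iic c) => S.φ x + (1 - c)) ∧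
      (∀ x : ↥(S.φ ⁻¹' Iic c), IsMCriticalPt (𝓡∂ 4) (fun x : ↥(S.φ ⁻¹' Iic c) => S.φ x + (1 - c)) x →
        morseIndex (𝓡∂ 4) (fun x : ↥(S.φ ⁻¹' Iic c) => S.φ x + (1 - c)) x ≤ 1) ∧
      (criticalSetOfIndex (𝓡∂ 4) (fun x : ↥(S.φ ⁻¹' Iic c) => S.φ x + (1 - c)) 0).ncard = 1 ∧
      (criticalSetOfIndex (𝓡∂ 4) (fun x : ↥(S.φ ⁻¹' Iic c) => S.φ x + (1 - c)) 1).ncard = 1 := by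
  obtain ⟨hcpt, hconn, hor, hrest⟩ := sublevel_handlebody_of_counts (k := 3) (by norm_num)
    S.φ_smooth (fun _ h => S.isInteriorPoint_of_φ_le hc h) hreg (fun z _ hz => hφ.2 z hz) hle h0 h1
  exact ⟨hcpt, hconn, hor S.isOrientable, hrest⟩

/-- **The sublevel set below the index-`2` level, packaged for handle calculus**: under the
hypotheses of `sublevel_oneOneHandlebody`, `V = {φ ≤ c}` is a compact connected orientable
smooth `4`-manifold with boundary carrying *some* adapted Morse function with indices `≤ 1`,
one critical point of index `0` and one of index `1` (the form consumed by the tree's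
handle-attachment and boundary-gluing predicates). [cite: Milnor1963, Thm. 3.1, Thm. 3.2 and Remark 3.3]
[cite: CieliebakEliashberg2012, §11] -/
theorem sublevel_oneOneHandlebody_exists (hφ : IsMorse (𝓡∂ 4) S.φ) {c : ℝ}
    (hc : c < sSup (range S.φ))
    (hreg : ∀ p, S.φ p = c → ¬ IsMCriticalPt (𝓡∂ 4) S.φ p)
    (hle : ∀ z, IsMCriticalPt (𝓡∂ 4) S.φ z → S.φ z < c → morseIndex (𝓡∂ 4) S.φ z ≤ 1)
    (h0 : (criticalSetOfIndex (𝓡∂ 4) S.φ 0 ∩ S.φ ⁻¹' Iio c).ncard = 1)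
    (h1 : (criticalSetOfIndex (𝓡∂ 4) S.φ 1 ∩ S.φ ⁻¹' Iio c).ncard = 1) :
    letI := (sublevelAtlas (k := 3) S.φ_smooth c (fun _ h => S.isInteriorPoint_of_φ_le hc h)
      hreg).chartedSpace
    haveI := (sublevelAtlas (k := 3) S.φ_smooth c (fun _ h => S.isInteriorPoint_of_φ_le hc h)
      hreg).isManifold
    CompactSpace ↥(S.φ ⁻¹' Iic c) ∧ ConnectedSpace ↥(S.φ ⁻¹' Iic c) ∧
      IsOrientable (𝓡∂ 4) ↥(S.φ ⁻¹' Iic c) ∧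
      ∃ f : ↥(S.φ ⁻¹' Iic c) → ℝ, IsMorseAdapted (𝓡∂ 4) f ∧
        (∀ z, IsMCriticalPt (𝓡∂ 4) f z → morseIndex (𝓡∂ 4) f z ≤ 1) ∧
        (criticalSetOfIndex (𝓡∂ 4) f 0).ncard = 1 ∧ (criticalSetOfIndex (𝓡∂ 4) f 1).ncard = 1 := by
  obtain ⟨hcpt, hconn, hor, -, -, hF, hidx, h0', h1'⟩ :=
    S.sublevel_oneOneHandlebody hφ hc hreg hle h0 h1
  exact ⟨hcpt, hconn, hor, _, hF, hidx, h0', h1'⟩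

/-- **The same, with the hypotheses in level-separated form**: if `φ` is a Morse function with
exactly one critical point of index `0` and exactly one of index `1`, and the critical points
of value `< c` (`c < max φ` a non-critical level) are precisely the critical points of index
`0` or `1`, then `{φ ≤ c}` is a compact connected orientable `(1,1)`-handlebody as in
`sublevel_oneOneHandlebody`. [cite: Milnor1963, Thm. 3.1, Thm. 3.2 and Remark 3.3]
[cite: CieliebakEliashberg2012, §11] -/
theorem sublevel_oneOneHandlebody_of_eq (hφ : IsMorse (𝓡∂ 4) S.φ) {c : ℝ}
    (hc : c < sSup (range S.φ))
    (hreg : ∀ p, S.φ p = c → ¬ IsMCriticalPt (𝓡∂ 4) S.φ p)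
    (hbelow : {z ∈ criticalSet (𝓡∂ 4) S.φ | S.φ z < c} =
      criticalSetOfIndex (𝓡∂ 4) S.φ 0 ∪ criticalSetOfIndex (𝓡∂ 4) S.φ 1)
    (h0 : (criticalSetOfIndex (𝓡∂ 4) S.φ 0).ncard = 1)
    (h1 : (criticalSetOfIndex (𝓡∂ 4) S.φ 1).ncard = 1) :
    letI := (sublevelAtlas (k := 3) S.φ_smooth c (fun _ h => S.isInteriorPoint_of_φ_le hc h)
      hreg).chartedSpace
    haveI := (sublevelAtlas (k := 3) S.φ_smooth c (fun _ h => S.isInteriorPoint_of_φ_le hc h)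
      hreg).isManifold
    CompactSpace ↥(S.φ ⁻¹' Iic c) ∧ ConnectedSpace ↥(S.φ ⁻¹' Iic c) ∧
      IsOrientable (𝓡∂ 4) ↥(S.φ ⁻¹' Iic c) ∧
      Manifold.IsSmoothEmbedding (𝓡∂ 4) (𝓡∂ 4) ∞ (Subtype.val : ↥(S.φ ⁻¹' Iic c) → W) ∧
      (∀ x : ↥(S.φ ⁻¹' Iic c), (𝓡∂ 4).IsBoundaryPoint x ↔ S.φ x.1 = c) ∧
      IsMorseAdapted (𝓡∂ 4) (fun x : ↥(S.φ ⁻¹' Iic c) => S.φ x + (1 - c)) ∧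
      (∀ x : ↥(S.φ ⁻¹' Iic c), IsMCriticalPt (𝓡∂ 4) (fun x : ↥(S.φ ⁻¹' Iic c) => S.φ x + (1 - c)) x →
        morseIndex (𝓡∂ 4) (fun x : ↥(S.φ ⁻¹' Iic c) => S.φ x + (1 - c)) x ≤ 1) ∧
      (criticalSetOfIndex (𝓡∂ 4) (fun x : ↥(S.φ ⁻¹' Iic c) => S.φ x + (1 - c)) 0).ncard = 1 ∧
      (criticalSetOfIndex (𝓡∂ 4) (fun x : ↥(S.φ ⁻¹' Iic c) => S.φ x + (1 - c)) 1).ncard = 1 := by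
  -- the critical points of index `0`, `1` all lie below `c`
  have hsub : ∀ i, i ≤ 1 → criticalSetOfIndex (𝓡∂ 4) S.φ i ∩ S.φ ⁻¹' Iio c =
      criticalSetOfIndex (𝓡∂ 4) S.φ i := by
    intro i hi
    apply inter_eq_left.2
    intro z hz
    have hz' : z ∈ {z ∈ criticalSet (𝓡∂ 4) S.φ | S.φ z < c} := by
      rw [hbelow]
      interval_cases i
      · exact Or.inl hz
      · exact Or.inr hz
    exact hz'.2
  have hle : ∀ z, IsMCriticalPt (𝓡∂ 4) S.φ z → S.φ z < c → morseIndex (𝓡∂ 4) S.φ z ≤ 1 := by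
    intro z hz hzc
    have hz' : z ∈ {z ∈ criticalSet (𝓡∂ 4) S.φ | S.φ z < c} := ⟨hz, hzc⟩
    rw [hbelow] at hz'
    rcases hz' with h | h
    · rw [h.2]; exact zero_le_one
    · rw [h.2]
  exact S.sublevel_oneOneHandlebody hφ hc hreg hle (by rw [hsub 0 zero_le_one]; exact h0)
    (by rw [hsub 1 le_rfl]; exact h1)

end SteinStructure

end Literature.Geometry.Symplectic

end
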